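import Summits.QuantumFields.YangMills.Theorems.BalabanUVNodesPortS1FlatLQt
import Literature.MathematicalPhysics.QuantumFieldTheory.Balaban1983to89.B7BlockAvgLog

/-!
# NODE O port PT-A — THE LETTER `RecordB0BlockInvertible` HOLDS AT THE FLAT BACKGROUND: `A₁(1) = (N_c ∕ |I|)·1`, hence `det A₁(1) ≠ 0` — print's «h is uniquely defined» (p.267) at the
# base point of the chart, with `h(c) = (|I| ∕ N_c)·1` (`N_c` = the number of central indices of the (0.4) index set `I`, `N_c ≥ 1`; `BlockAveragingHaarAC.nCentral`)

Cell `ym-nodeO-ideate`, porter seat `ymgap-nodeO-port-PTA-1` (gen 4); `--supports stmt-QuantumFields-27930` (helper; K7-c at the base point for the letter displayed by `…PortS1ZkGraph`, `…PortS1PhiLZLogDet`,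
`…PortS1PhiLZResolvent`).  [I] = [Balaban1987RG1], [B7] = [Balaban1985Averaging].
THE ARGUMENT (multiplicative, in the tree's (0.4) normal form).  Perturb the unit configuration on the central bond `b₀(c)` only: `U_t = 1[b₀(c) ↦ g_t]`, `g_t = exp(t·su2Gen a)`.  By
`BlockAveragingHaarAC`: `U_t(c) = pre·g_t·post = g_t` (`axialAvg_update_centralBond`), the open holonomies are `g_t` at CENTRAL indices (FACT B, `openHol_of_isCentral`) and `1` at the others (FACT A,
`openHol_update_of_not_isCentral`), so the loop variables are `1` resp. `g_t⁻¹`; the exp-mean-log of that commuting family is `exp(−(1 − N_c∕|I|)·t·su2Gen a)` (`eml_eq_exp`, `mlog_exp`), hence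
`M(U_t)(c) = exp((N_c∕|I|)·t·su2Gen a)` and `Q̃(1, t·e)(c) = (N_c∕|I|)·t·su2Gen a` for small `t`; with the differentiability of `Q̃(1,·)` at `0` (`…PortS1FlatLQt`) the `b₀`-block of `LQ̃(1)` is
`(N_c∕|I|)·1`.
* §1 the one-bond perturbation of the flat field: `fluctMat_smul_single`, `coe_bondExp`, `axialAvg_pert_one`, `openHol_pert_one`, `loopHol_pert_one`.
* §2 the average and `Q̃` in closed form for small `t`: `corr_pert_one`, `avgFun_pert_one`, `recordQt_one_smul_single`.
* §3 ★★ `recordLQt_one_single_b0` (`LQ̃(1) e_{(b₀(c),a)} (c) = (N_c∕|I|)·su2Gen a`), ★★ `recordLQtB0_one` (`A₁(1) = (N_c∕|I|)·1` entrywise), ★★★ `recordB0BlockInvertible_one`.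

HONEST FRAMING.  The flat base point only; NOTHING of Bałaban's estimates asserted or discharged (the letter at a general background `V^{(k)}(W_B)` is NOT proved); 27930 OPEN; K0⁷∕K-Ax OPEN; NODE O
0∕1; COUNT 8∕28 · K 1∕4 UNMOVED; finite `𝕋⁴_{L^K}` at fixed ε — NOT continuum ∕ OS ∕ Clay; **the Yang–Mills mass gap is NOT proved by any of this.**  No `sorry`, no `def`, no `instance`.
-/

noncomputable section

open scoped BigOperators Matrix.Norms.L2Operator Topology

namespace Summit.QuantumFields.YangMills.Theorems.BalabanUVNodesPortS1

open Summit.QuantumFields.YangMills.Theorems.K0RecordFormatNames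
open Literature.MathematicalPhysics.QuantumFieldTheory.Balaban1983to89
open Literature.MathematicalPhysics.QuantumFieldTheory.Balaban1983to89.Node00
open Literature.MathematicalPhysics.QuantumFieldTheory.Balaban1983to89.T4Continuum (T4Family)
open Literature.MathematicalPhysics.QuantumFieldTheory.Balaban1983to89.BlockAveraging (avgFun loopHol corr Small Idx)
open Literature.MathematicalPhysics.QuantumFieldTheory.Balaban1983to89.BlockAveragingHaarAC (openHol IsCentral nCentral centralBond pre post)
open Literature.MathematicalPhysics.QuantumFieldTheory.Balaban1983to89.AveragingRT (axialAvg)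
open Literature.MathematicalPhysics.QuantumFieldTheory.Balaban1983to89.ExpMeanLog (expMeanLogSU eml ESU deltaSU)
open NormedSpace (exp)
open _root_.Matrix _root_.Filter

variable (F : T4Family)

/-! ## §1  The one-bond perturbation of the flat field in the (0.4) normal form -/

/-- `fluctMat (t·e_{(b,a)}) b = t·su2Gen a`. [cite: Balaban1987RG1, (2.4) p.266 (bookkeeping)] -/
theorem fluctMat_smul_single (k K : ℕ) (b : PBond (F.P K) k) (a : Fin 3) (t : ℝ) :
    fluctMat F k K (t • (Pi.single (b, a) (1 : ℝ) : FluctIdx F k K → ℝ)) b = (t : ℂ) • su2Gen a := by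
  classical
  simp only [fluctMat, Pi.smul_apply, smul_eq_mul]
  rw [Finset.sum_eq_single a]
  · simp
  · intro a' _ ha'
    have : (b, a') ≠ (b, a) := fun h => ha' (Prod.mk.inj h).2
    simp [this]
  · intro h; exact absurd (Finset.mem_univ a) h

/-- The perturbed value on the central bond: `(U_t(b₀(c)) : M₂(ℂ)) = exp(t·su2Gen a)`. [cite: Balaban1987RG1, (2.4) p.266] -/
theorem coe_pert_one_single (k K : ℕ) (b : PBond (F.P K) k) (a : Fin 3) (t : ℝ) :
    ((pert F k K 1 (t • (Pi.single (b, a) (1 : ℝ) : FluctIdx F k K → ℝ)) b : SU 2) : MatA 2) = exp ((t : ℂ) • su2Gen a) := by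
  rw [coe_pert_one, fluctMat_smul_single]

/-- `pre 1 c = 1`, `post 1 c = 1` (holonomies of the unit field). [folklore] -/
theorem pre_one_post_one (k K : ℕ) (c : PBond (F.P K) (k + 1)) :
    pre (1 : GaugeField (F.P K) k (SU 2)) c = 1 ∧ post (1 : GaugeField (F.P K) k (SU 2)) c = 1 :=
  ⟨T3DescentFibreTower.holAt_one _, T3DescentFibreTower.holAt_one _⟩

open Classical in
/-- **The coarse bond variable of `U_t`**: `U_t(c) = g_t` (`axialAvg_update_centralBond` with `pre = post = 1`). [cite: Balaban1987RG1, (0.4) p.253, p.267] -/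
theorem axialAvg_pert_one (k K : ℕ) (hk : k + 1 ≤ (F.P K).m + (F.P K).K) (c : PBond (F.P K) (k + 1)) (a : Fin 3) (t : ℝ) :
    axialAvg (pert F k K 1 (t • (Pi.single (recordB0 F k K c, a) (1 : ℝ) : FluctIdx F k K → ℝ))) c =
      pert F k K 1 (t • (Pi.single (recordB0 F k K c, a) (1 : ℝ) : FluctIdx F k K → ℝ)) (recordB0 F k K c) := by
  rw [pert_smul_single_eq_update]
  rw [Function.update_self]
  have h := BlockAveragingHaarAC.axialAvg_update_centralBond (G := SU 2) hk (1 : GaugeField (F.P K) k (SU 2)) c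
    (pert F k K 1 (t • (Pi.single (recordB0 F k K c, a) (1 : ℝ) : FluctIdx F k K → ℝ)) (recordB0 F k K c))
  rw [(pre_one_post_one F k K c).1, (pre_one_post_one F k K c).2, one_mul, mul_one] at h
  exact h

open Classical in
/-- **The open holonomies of `U_t`**: `g_t` at central indices (FACT B), `1` at the others (FACT A). [cite: Balaban1987RG1, (0.4) p.253] -/
theorem openHol_pert_one (k K : ℕ) (hk : k + 1 ≤ (F.P K).m + (F.P K).K) (c : PBond (F.P K) (k + 1)) (a : Fin 3) (t : ℝ) (i : Idx (F.P K)) :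
    openHol (pert F k K 1 (t • (Pi.single (recordB0 F k K c, a) (1 : ℝ) : FluctIdx F k K → ℝ))) c i =
      if IsCentral c i then pert F k K 1 (t • (Pi.single (recordB0 F k K c, a) (1 : ℝ) : FluctIdx F k K → ℝ)) (recordB0 F k K c) else 1 := by
  split_ifs with h
  · rw [BlockAveragingHaarAC.openHol_of_isCentral _ c i h, axialAvg_pert_one F k K hk]
  · rw [pert_smul_single_eq_update]
    have h1 := BlockAveragingHaarAC.openHol_update_of_not_isCentral (G := SU 2) hk (1 : GaugeField (F.P K) k (SU 2)) c i h
      (pert F k K 1 (t • (Pi.single (recordB0 F k K c, a) (1 : ℝ) : FluctIdx F k K → ℝ)) (recordB0 F k K c))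
    exact h1.trans (T3DescentFibreTower.holAt_one _)

open Classical in
/-- **The loop variables of `U_t`**: `1` at central indices, `g_t⁻¹` at the others. [cite: Balaban1987RG1, (0.4) p.253] -/
theorem loopHol_pert_one (k K : ℕ) (hk : k + 1 ≤ (F.P K).m + (F.P K).K) (c : PBond (F.P K) (k + 1)) (a : Fin 3) (t : ℝ) (i : Idx (F.P K)) :
    loopHol (pert F k K 1 (t • (Pi.single (recordB0 F k K c, a) (1 : ℝ) : FluctIdx F k K → ℝ))) c i =
      if IsCentral c i then 1 else (pert F k K 1 (t • (Pi.single (recordB0 F k K c, a) (1 : ℝ) : FluctIdx F k K → ℝ)) (recordB0 F k K c))⁻¹ := by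
  rw [BlockAveragingHaarAC.loopHol_eq_openHol_mul, openHol_pert_one F k K hk, axialAvg_pert_one F k K hk]
  split_ifs with h
  · exact mul_inv_cancel _
  · exact one_mul _


/-! ## §2  The average of `U_t` and `Q̃(1, t·e)` in closed form for small `t` -/

/-- The inverse of the perturbed value: `(g_t⁻¹ : M₂(ℂ)) = exp(−t·su2Gen a)`. [folklore] -/
theorem coe_inv_pert_one_single (k K : ℕ) (b : PBond (F.P K) k) (a : Fin 3) (t : ℝ) :
    (((pert F k K 1 (t • (Pi.single (b, a) (1 : ℝ) : FluctIdx F k K → ℝ)) b)⁻¹ : SU 2) : MatA 2) = exp (-((t : ℂ) • su2Gen a)) := by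
  have hinv : ∀ g : SU 2, ((g⁻¹ : SU 2) : MatA 2) = star (g : MatA 2) := fun g => rfl
  rw [hinv, coe_pert_one_single, NormedSpace.star_exp, star_smul, star_su2Gen, Complex.star_def, Complex.conj_ofReal, smul_neg]

open Classical in
/-- **The correction factor of `U_t`** on the small-field guard: the exp-mean-log of the family `{1 (central), g_t⁻¹ (non-central)}` is `exp(−(|I| − N_c)∕|I| · t·su2Gen a)`.
[cite: Balaban1987RG1, (0.4) p.253] -/
theorem coe_corr_pert_one (k K : ℕ) (hk : k + 1 ≤ (F.P K).m + (F.P K).K) (c : PBond (F.P K) (k + 1)) (a : Fin 3) (t : ℝ)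
    (hδ : ‖exp ((t : ℂ) • su2Gen a) - 1‖ < deltaSU (Fin 2)) (hlog : ‖(t : ℂ) • su2Gen a‖ < Real.log 2) :
    ((corr expMeanLogSU (pert F k K 1 (t • (Pi.single (recordB0 F k K c, a) (1 : ℝ) : FluctIdx F k K → ℝ))) c : SU 2) : MatA 2) =
      exp ((((Fintype.card (Idx (F.P K)) : ℂ))⁻¹ * ((Fintype.card (Idx (F.P K)) : ℂ) - (nCentral c : ℂ)) * (-(t : ℂ))) • su2Gen a) := by
  set U := pert F k K 1 (t • (Pi.single (recordB0 F k K c, a) (1 : ℝ) : FluctIdx F k K → ℝ)) with hU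
  set g : SU 2 := U (recordB0 F k K c) with hg
  have hgcoe : ((g⁻¹ : SU 2) : MatA 2) = exp (-((t : ℂ) • su2Gen a)) := coe_inv_pert_one_single F k K _ a t
  have hginv_norm : ‖((g⁻¹ : SU 2) : MatA 2) - 1‖ < deltaSU (Fin 2) := by
    have h1 : dist1 (g⁻¹) = dist1 g := GaugeGroup.dist1_inv g
    have h2 : dist1 g = ‖(g : MatA 2) - 1‖ := rfl
    have h3 : dist1 (g⁻¹) = ‖((g⁻¹ : SU 2) : MatA 2) - 1‖ := rfl
    rw [← h3, h1, h2, hg, coe_pert_one_single]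
    exact hδ
  have hloop : ∀ i, loopHol U c i = if IsCentral c i then 1 else g⁻¹ := fun i => loopHol_pert_one F k K hk c a t i
  -- the small-field guard holds
  have hsmall : Small expMeanLogSU U c := by
    intro i
    rw [hloop i]
    split_ifs
    · rw [GaugeGroup.dist1_one]; exact ExpMeanLog.deltaSU_pos
    · show ‖((g⁻¹ : SU 2) : MatA 2) - 1‖ < deltaSU (Fin 2)
      exact hginv_norm
  have hguard : ∀ i : Fin (Fintype.card (Idx (F.P K)) - 1 + 1),
      ‖(((loopHol U c ∘ (LoopAverage.enum (Idx (F.P K))).symm) i : SU 2) : MatA 2) - 1‖ < deltaSU (Fin 2) := by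
    intro i
    simp only [Function.comp_apply, hloop]
    split_ifs
    · rw [OneMemClass.coe_one, sub_self, norm_zero]; exact ExpMeanLog.deltaSU_pos
    · exact hginv_norm
  -- unfold the correction factor on the guard
  rw [corr, if_pos hsmall, LoopAverage.avg]
  show ((ESU (loopHol U c ∘ (LoopAverage.enum (Idx (F.P K))).symm) : SU 2) : MatA 2) = _
  rw [ExpMeanLog.coe_ESU_of_small hguard, ExpMeanLog.eml_eq_exp]
  congr 1
  -- the mean of the logarithms
  have hsum : ∑ i : Fin (Fintype.card (Idx (F.P K)) - 1 + 1), MatrixLog.mlog ((((loopHol U c ∘ (LoopAverage.enum (Idx (F.P K))).symm) i : SU 2) : MatA 2))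
      = ∑ i : Idx (F.P K), MatrixLog.mlog (((loopHol U c i : SU 2) : MatA 2)) :=
    Equiv.sum_comp (LoopAverage.enum (Idx (F.P K))).symm (fun i => MatrixLog.mlog (((loopHol U c i : SU 2) : MatA 2)))
  have hcard : (Fintype.card (Fin (Fintype.card (Idx (F.P K)) - 1 + 1)) : ℂ) = (Fintype.card (Idx (F.P K)) : ℂ) := by
    rw [Fintype.card_congr (LoopAverage.enum (Idx (F.P K))).symm]
  rw [hcard, hsum]
  have hterm : ∀ i : Idx (F.P K), MatrixLog.mlog (((loopHol U c i : SU 2) : MatA 2)) = if IsCentral c i then 0 else -((t : ℂ) • su2Gen a) := by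
    intro i
    rw [hloop i]
    split_ifs
    · rw [OneMemClass.coe_one, MatrixLog.mlog_one]
    · rw [hgcoe]
      exact B7BlockAvgLog.mlog_exp (by rwa [norm_neg])
  simp_rw [hterm]
  rw [Finset.sum_ite, Finset.sum_const_zero, zero_add, Finset.sum_const, ← Finset.card_univ, nCentral]
  have hcardsplit := Finset.card_filter_add_card_filter_not (s := (Finset.univ : Finset (Idx (F.P K)))) (IsCentral c)
  have hnc : ((Finset.univ.filter fun i => ¬IsCentral c i).card : ℂ) = (Finset.univ : Finset (Idx (F.P K))).card - (Finset.univ.filter (IsCentral c)).card := by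
    rw [eq_sub_iff_add_eq, add_comm]
    exact_mod_cast hcardsplit
  rw [← Nat.cast_smul_eq_nsmul ℂ, hnc, smul_neg, smul_smul, smul_neg, smul_smul, ← neg_smul]
  congr 1
  ring

open Classical in
/-- **The (0.4) average of `U_t` at `c`**: `M(U_t)(c) = exp((N_c∕|I|)·t·su2Gen a)` (correction factor times `U_t(c) = g_t`, commuting exponentials). [cite: Balaban1987RG1, (0.4) p.253] -/
theorem coe_avgFun_pert_one (k K : ℕ) (hk : k + 1 ≤ (F.P K).m + (F.P K).K) (c : PBond (F.P K) (k + 1)) (a : Fin 3) (t : ℝ)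
    (hδ : ‖exp ((t : ℂ) • su2Gen a) - 1‖ < deltaSU (Fin 2)) (hlog : ‖(t : ℂ) • su2Gen a‖ < Real.log 2) :
    ((avgFun expMeanLogSU (pert F k K 1 (t • (Pi.single (recordB0 F k K c, a) (1 : ℝ) : FluctIdx F k K → ℝ))) c : SU 2) : MatA 2) =
      exp ((((nCentral c : ℂ)) / (Fintype.card (Idx (F.P K)) : ℂ) * (t : ℂ)) • su2Gen a) := by
  letI : NormedAlgebra ℚ (MatA 2) := NormedAlgebra.restrictScalars ℚ ℂ (MatA 2)
  have hI : ((Fintype.card (Idx (F.P K)) : ℂ)) ≠ 0 := by exact_mod_cast Fintype.card_ne_zero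
  rw [BlockAveraging.avgFun, Submonoid.coe_mul, coe_corr_pert_one F k K hk c a t hδ hlog, axialAvg_pert_one F k K hk, coe_pert_one_single,
    ← NormedSpace.exp_add_of_commute (((Commute.refl (su2Gen a)).smul_left _).smul_right _), ← add_smul]
  congr 2
  field_simp
  ring

open Classical in
/-- **`Q̃(1, t·e_{(b₀(c),a)})(c) = (N_c∕|I|)·t·su2Gen a`** for small `t`. [cite: Balaban1987RG1, p.267, (0.4) p.253] -/
theorem recordQt_one_smul_single (k K : ℕ) (hk : k + 1 ≤ (F.P K).m + (F.P K).K) (c : PBond (F.P K) (k + 1)) (a : Fin 3) (t : ℝ)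
    (hδ : ‖exp ((t : ℂ) • su2Gen a) - 1‖ < deltaSU (Fin 2)) (hlog : ‖(t : ℂ) • su2Gen a‖ < Real.log 2)
    (hlog' : ‖((((nCentral c : ℂ)) / (Fintype.card (Idx (F.P K)) : ℂ) * (t : ℂ)) • su2Gen a)‖ < Real.log 2) :
    recordQt F k K 1 (t • (Pi.single (recordB0 F k K c, a) (1 : ℝ) : FluctIdx F k K → ℝ)) c =
      ((((nCentral c : ℂ)) / (Fintype.card (Idx (F.P K)) : ℂ) * (t : ℂ)) • su2Gen a) := by
  rw [recordQt_one_apply, coe_avgFun_pert_one F k K hk c a t hδ hlog]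
  exact B7BlockAvgLog.mlog_exp hlog'

/-! ## §3  ★★ The `b₀`-block of `LQ̃(1)` and the letter at the flat background -/

open Classical in
/-- ★★ **`LQ̃(1) e_{(b₀(c),a)} (c) = (N_c∕|I|)·su2Gen a`** — the derivative at `t = 0` of `t ↦ Q̃(1, t·e)(c) = (N_c∕|I|)·t·su2Gen a` (small `t`), read through the differentiability of `Q̃(1, ·)` at `0`
(`…PortS1FlatLQt`). [cite: Balaban1987RG1, p.267 («LQ̃h = I»), (0.4) p.253] -/
theorem recordLQt_one_single_b0 (k K : ℕ) (hk : k + 1 ≤ (F.P K).m + (F.P K).K) (c : PBond (F.P K) (k + 1)) (a : Fin 3) :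
    recordLQt F k K 1 (Pi.single (recordB0 F k K c, a) (1 : ℝ)) c = (((nCentral c : ℂ)) / (Fintype.card (Idx (F.P K)) : ℂ)) • su2Gen a := by
  set e : FluctIdx F k K → ℝ := Pi.single (recordB0 F k K c, a) (1 : ℝ) with he
  set ρ : ℂ := ((nCentral c : ℂ)) / (Fintype.card (Idx (F.P K)) : ℂ) with hρ
  -- (i) the derivative along the line from `Q̃`'s Fréchet derivative
  have hd := (differentiableAt_recordQt_one_and_recordLQt_one_apply F k K).1
  have h1 : HasFDerivAt (recordQt F k K 1) (recordLQt F k K 1) ((fun s : ℝ => s • e) 0) := by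
    simpa [recordLQt] using hd.hasFDerivAt
  have hline : HasDerivAt (fun s : ℝ => s • e) e 0 := by simpa using (hasDerivAt_id (0 : ℝ)).smul_const e
  have hcomp : HasDerivAt (recordQt F k K 1 ∘ fun s : ℝ => s • e) (recordLQt F k K 1 e) 0 := h1.comp_hasDerivAt (0 : ℝ) hline
  have hcoord : HasDerivAt (fun s : ℝ => (recordQt F k K 1 ∘ fun s : ℝ => s • e) s c) (recordLQt F k K 1 e c) 0 := (hasDerivAt_pi.mp hcomp) c
  -- (ii) the explicit derivative of the closed form, valid eventually
  have hev : ∀ᶠ s : ℝ in 𝓝 0, (recordQt F k K 1 ∘ fun s : ℝ => s • e) s c = ((s : ℂ) * ρ) • su2Gen a := by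
    have hcont : Continuous fun s : ℝ => (s : ℂ) • su2Gen a := Complex.continuous_ofReal.smul continuous_const
    have h0 : (fun s : ℝ => (s : ℂ) • su2Gen a) 0 = 0 := by simp
    letI : NormedAlgebra ℚ (MatA 2) := NormedAlgebra.restrictScalars ℚ ℂ (MatA 2)
    have hlog_ev : ∀ᶠ s : ℝ in 𝓝 0, ‖(s : ℂ) • su2Gen a‖ < Real.log 2 := by
      have hc1 : Continuous fun s : ℝ => ‖(s : ℂ) • su2Gen a‖ := continuous_norm.comp hcont
      have ht : Tendsto (fun s : ℝ => ‖(s : ℂ) • su2Gen a‖) (𝓝 0) (𝓝 0) := hc1.tendsto' 0 0 (by simp)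
      exact ht.eventually_lt_const (Real.log_pos one_lt_two)
    have hδ_ev : ∀ᶠ s : ℝ in 𝓝 0, ‖exp ((s : ℂ) • su2Gen a) - 1‖ < deltaSU (Fin 2) := by
      have hc2 : Continuous fun s : ℝ => ‖exp ((s : ℂ) • su2Gen a) - 1‖ :=
        continuous_norm.comp ((NormedSpace.exp_continuous.comp hcont).sub continuous_const)
      have ht : Tendsto (fun s : ℝ => ‖exp ((s : ℂ) • su2Gen a) - 1‖) (𝓝 0) (𝓝 0) := hc2.tendsto' 0 0 (by simp)
      exact ht.eventually_lt_const ExpMeanLog.deltaSU_pos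
    have hlog'_ev : ∀ᶠ s : ℝ in 𝓝 0, ‖((ρ * (s : ℂ)) • su2Gen a)‖ < Real.log 2 := by
      have hc3 : Continuous fun s : ℝ => ‖((ρ * (s : ℂ)) • su2Gen a)‖ :=
        continuous_norm.comp ((continuous_const.mul Complex.continuous_ofReal).smul continuous_const)
      have ht : Tendsto (fun s : ℝ => ‖((ρ * (s : ℂ)) • su2Gen a)‖) (𝓝 0) (𝓝 0) := hc3.tendsto' 0 0 (by simp)
      exact ht.eventually_lt_const (Real.log_pos one_lt_two)
    filter_upwards [hlog_ev, hδ_ev, hlog'_ev] with s hs1 hs2 hs3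
    rw [Function.comp_apply, recordQt_one_smul_single F k K hk c a s hs2 hs1 hs3, mul_comm]
  have hexpl : HasDerivAt (fun s : ℝ => ((s : ℂ) * ρ) • su2Gen a) (((1 : ℂ) * ρ) • su2Gen a) 0 := by
    have h := ((Complex.ofRealCLM.hasDerivAt (x := (0 : ℝ))).mul_const ρ).smul_const (su2Gen a)
    simpa using h
  have h2 : HasDerivAt (fun s : ℝ => (recordQt F k K 1 ∘ fun s : ℝ => s • e) s c) (((1 : ℂ) * ρ) • su2Gen a) 0 :=
    hexpl.congr_of_eventuallyEq hev
  rw [one_mul] at h2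
  exact hcoord.unique h2

open Classical in
/-- ★★ **THE `b₀`-BLOCK OF `LQ̃(1)` IS SCALAR**: `A₁(1) ((c, j), (c, a)) = (N_c∕|I|)·δ_{ja}`. [cite: Balaban1987RG1, p.267 («h(c)»)] -/
theorem recordLQtB0_one (k K : ℕ) (hk : k + 1 ≤ (F.P K).m + (F.P K).K) (c : PBond (F.P K) (k + 1)) (j a : Fin 3) :
    recordLQtB0 F k K 1 (c, j) (c, a) = if j = a then ((nCentral c : ℝ)) / (Fintype.card (Idx (F.P K)) : ℝ) else 0 := by
  set r : ℝ := ((nCentral c : ℝ)) / (Fintype.card (Idx (F.P K)) : ℝ) with hr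
  have hρ : (((nCentral c : ℂ)) / (Fintype.card (Idx (F.P K)) : ℂ)) • su2Gen a = r • su2Gen a := by
    rw [hr, ← Complex.coe_smul]
    push_cast
    rfl
  have hlin : ∀ M : MatA 2, su2Coord (r • M) j = r * su2Coord M j := by
    intro M
    fin_cases j <;> simp [su2Coord]
  have hgen : su2Coord (su2Gen a) j = if j = a then 1 else 0 := by
    fin_cases j <;> fin_cases a <;> simp [su2Coord, su2Gen]
  simp only [recordLQtB0, recordLQtMat]
  rw [recordLQt_one_single_b0 F k K hk c a, hρ, hlin, hgen, mul_ite, mul_one, mul_zero]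

open Classical in
/-- ★★★ **THE LETTER AT THE FLAT BACKGROUND**: `RecordB0BlockInvertible F k K 1` — the `b₀`-block of `LQ̃(1)` is `(N_c∕|I|)·1` blockwise (`N_c ≥ 1`), its determinant `∏_c (N_c∕|I|)³ ≠ 0`
(print's «h is uniquely defined», p.267, at the base point; `h(c) = (|I|∕N_c)·1`). [cite: Balaban1987RG1, p.267–268, (1.4) p.260] -/
theorem recordB0BlockInvertible_one (k K : ℕ) (hk : k + 1 ≤ (F.P K).m + (F.P K).K) :
    RecordB0BlockInvertible F k K (1 : GaugeField (F.P K) k (SU 2)) := by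
  rw [RecordB0BlockInvertible, isUnit_iff_ne_zero, det_recordLQtB0_eq_prod F k K hk, Finset.prod_ne_zero_iff]
  intro c _
  have hρ : (0 : ℝ) < ((nCentral c : ℝ)) / (Fintype.card (Idx (F.P K)) : ℝ) :=
    div_pos (by exact_mod_cast BlockAveragingHaarAC.nCentral_pos c) (by exact_mod_cast Fintype.card_pos)
  have hblock : (Matrix.of fun j j' : Fin 3 => recordLQtB0 F k K 1 (c, j) (c, j')) =
      (((nCentral c : ℝ)) / (Fintype.card (Idx (F.P K)) : ℝ)) • (1 : Matrix (Fin 3) (Fin 3) ℝ) := by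
    ext j j'
    rw [Matrix.of_apply, recordLQtB0_one F k K hk c j j', Matrix.smul_apply, Matrix.one_apply, smul_eq_mul, mul_ite, mul_one, mul_zero]
  rw [hblock, Matrix.det_smul, Matrix.det_one, mul_one, Fintype.card_fin]
  exact pow_ne_zero _ hρ.ne'

end Summit.QuantumFields.YangMills.Theorems.BalabanUVNodesPortS1

end
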